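import Literature.NumberTheory.LFunctions.RealCharacterDivisorSumsLevel
import Literature.NumberTheory.LFunctions.SmoothEulerProductSandwich
import Literature.NumberTheory.LFunctions.ExceptionalPrimesPowerSums
import Literature.NumberTheory.LFunctions.ApproxFunctionalEquation
import HarnessLib

/-!
# Two inputs for `L(1, χ)` under an exceptional zero, restated from the tree: the power sums
# `∑_{b ≤ t} b^{-β} = t^{1−β}/(1−β) + ζ(β) + O(t^{-β})` and `∑_{n ≤ N} r(n)/n ≤ ∏_{p ≤ N} (1−1/p)⁻¹(1−χ(p)/p)⁻¹`

Topic `Literature/NumberTheory/LFunctions`, continuing `RealCharacterDivisorSumsLevel.lean`.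
Everything is PROVED; this file only packages, in the notation of the `RealChar` files
(`Finset.Ioc 0 M`-sums, `reChar χ`, `charDivisorSum χ`), results the directory already has:

* `PowerSum.zsum β M = Z_β(M) = ∑_{b=1}^{M} b^{-β}` (notation) and, for `0 < β < 1`,
  `PowerSum.abs_zsum_sub_sub_zeta_le` — `|Z_β(M) − M^{1−β}/(1−β) − ζ(β)| ≤ M^{-β}` (`M ≥ 1`), the
  real-axis case of the tree's Euler–Maclaurin estimate
  `Literature.NumberTheory.LFunctions.AFE.norm_zeta_sub_sum_add_le` (Titchmarsh (4.11.2):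
  `‖ζ(s) − ∑_{n ≤ N} n^{-s} + N^{1-s}/(1-s)‖ ≤ N^{-σ}(1/2 + |s|/(2σ))`, the factor being `1` at a
  real `s = β`); here `ζ(β)` is Mathlib's `riemannZeta β` (its real part; `ζ(β) < 0` on `(0,1)`
  is not needed). Consequences: `abs_re_zeta_le` (`|ζ(β)| ≤ 1/(1−β)`, the case `M = 1`),
  `zsum_le` (`Z_β(M) ≤ M^{1−β}/(1−β)`, from the tree's
  `Literature.NumberTheory.LFunctions.SiegelZero.sum_Icc_rpow_le`), and the real-variable form
  `abs_zsum_floor_sub_le`: `|Z_β(⌊t⌋) − t^{1−β}/(1−β) − ζ(β)| ≤ 4 t^{-β}` for `t ≥ 1` (with the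
  tree's floor lemma `SiegelZero.rpow_sub_floor_rpow_bounds`).
* `RealChar.sum_charDivisorSum_div_le_prod` — **the smooth-number majorant**: for quadratic `χ`,
  `∑_{n ≤ N} r(n)/n ≤ ∏_{p ≤ N} ((1 − 1/p)(1 − χ(p)/p))⁻¹`, a restatement for
  `r = charDivisorSum χ` of the tree's
  `Literature.NumberTheory.LFunctions.SmoothEulerProduct.sum_le_smoothProduct` (every `n ≤ N` is
  `(N+1)`-smooth; Mathlib's Euler product over smooth numbers).

These are exactly the two facts about `∑ b^{-β}` and `∑ r(n)/n` consumed by the hyperbola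
argument of `ExceptionalZeroLOneBound.lean`; the constant `ζ(β)` matters there because `Z_β(⌊N/a⌋)`
is summed against the oscillating weights `χ(a) a^{-β}`, whose sum is small only after the common
constant is extracted.

## References

* E. C. Titchmarsh, *The Theory of the Riemann Zeta-Function*, 2nd ed. (1986), (4.11.2).
  [Titchmarsh1986]
* H. Davenport, *Multiplicative Number Theory*, 2nd ed., GTM 74 (1980), Ch. 6 and Ch. 14.
  [DavenportMNT1980]
-/

noncomputable section

open Finset ArithmeticFunction
open scoped ArithmeticFunction.zeta

namespace Literature.NumberTheory.LFunctions

/-! ## Power sums `Z_β(M) = ∑_{b ≤ M} b^{-β}` against `ζ(β)` -/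

namespace PowerSum

/-- `Z_β(M) = ∑_{b=1}^{M} b^{-β}` (the tree's `∑_{n ∈ Icc 1 M} n^{-β}` of
`ExceptionalPrimesPowerSums.lean`, written over `Finset.Ioc 0 M`). [folklore] -/
def zsum (β : ℝ) (M : ℕ) : ℝ := ∑ b ∈ Ioc 0 M, (b : ℝ) ^ (-β)

/-- `Z_β(0) = 0`. [folklore] -/
@[simp] theorem zsum_zero (β : ℝ) : zsum β 0 = 0 := by simp [zsum]

/-- `Z_β(M+1) = Z_β(M) + (M+1)^{-β}`. [folklore] -/
theorem zsum_succ (β : ℝ) (M : ℕ) : zsum β (M + 1) = zsum β M + ((M + 1 : ℕ) : ℝ) ^ (-β) := by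
  rw [zsum, zsum, sum_Ioc_succ_top (Nat.zero_le M)]

/-- `Z_β(1) = 1`. [folklore] -/
theorem zsum_one (β : ℝ) : zsum β 1 = 1 := by
  rw [zsum_succ, zsum_zero]; simp

/-- `Z_β(M) ≥ 0`. [folklore] -/
theorem zsum_nonneg (β : ℝ) (M : ℕ) : 0 ≤ zsum β M :=
  sum_nonneg fun b _ => by positivity

/-- Bridge to the `Icc 1 M` indexing of `ExceptionalPrimesPowerSums.lean`. [folklore] -/
theorem zsum_eq_sum_Icc (β : ℝ) (M : ℕ) : zsum β M = ∑ n ∈ Icc 1 M, (n : ℝ) ^ (-β) := by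
  rw [zsum, show Finset.Icc 1 M = Finset.Ioc 0 M from rfl]

variable {β : ℝ}

/-- **Euler–Maclaurin on the real axis**: for `0 < β < 1` and `M ≥ 1`,
`|Z_β(M) − M^{1−β}/(1−β) − ζ(β)| ≤ M^{-β}` — the case `s = β` of the tree's
`AFE.norm_zeta_sub_sum_add_le` (Titchmarsh (4.11.2)), where the factor `1/2 + |s|/(2σ)` is `1`.
[cite: Titchmarsh1986, eq. (4.11.2)] -/
theorem abs_zsum_sub_sub_zeta_le (hβ0 : 0 < β) (hβ1 : β < 1) {M : ℕ} (hM : 1 ≤ M) :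
    |zsum β M - (M : ℝ) ^ (1 - β) / (1 - β) - (riemannZeta β).re| ≤ (M : ℝ) ^ (-β) := by
  have hs : (0 : ℝ) < (β : ℂ).re := by simpa using hβ0
  have hs1 : (β : ℂ) ≠ 1 := by
    intro h
    have := congrArg Complex.re h
    simp at this
    linarith
  have h := AFE.norm_zeta_sub_sum_add_le hs hs1 hM
  have hfac : (1 / 2 + ‖(β : ℂ)‖ / (2 * (β : ℂ).re)) = 1 := by
    rw [Complex.norm_real, Real.norm_eq_abs, abs_of_pos hβ0, Complex.ofReal_re]
    field_simp
    ring
  rw [hfac, mul_one, Complex.ofReal_re] at h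
  -- the sum and the power are real
  have hsum : ∑ n ∈ Finset.Icc 1 M, (n : ℂ) ^ (-(β : ℂ)) = ((zsum β M : ℝ) : ℂ) := by
    rw [zsum_eq_sum_Icc, Complex.ofReal_sum]
    refine sum_congr rfl fun n _ => ?_
    rw [show (n : ℂ) = ((n : ℝ) : ℂ) by simp, ← Complex.ofReal_neg,
      ← Complex.ofReal_cpow (Nat.cast_nonneg n)]
  have hpow : (M : ℂ) ^ (1 - (β : ℂ)) / (1 - (β : ℂ)) = (((M : ℝ) ^ (1 - β) / (1 - β) : ℝ) : ℂ) := by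
    have e1 : (1 : ℂ) - (β : ℂ) = ((1 - β : ℝ) : ℂ) := by push_cast; ring
    rw [e1, show (M : ℂ) = ((M : ℝ) : ℂ) by simp, ← Complex.ofReal_cpow (Nat.cast_nonneg M),
      ← Complex.ofReal_div]
  have key : (riemannZeta β - ∑ n ∈ Finset.Icc 1 M, (n : ℂ) ^ (-(β : ℂ)) +
      (M : ℂ) ^ (1 - (β : ℂ)) / (1 - (β : ℂ))).re =
      (riemannZeta β).re - zsum β M + (M : ℝ) ^ (1 - β) / (1 - β) := by
    rw [Complex.add_re, Complex.sub_re, hsum, hpow, Complex.ofReal_re, Complex.ofReal_re]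
  have h' := (Complex.abs_re_le_norm _).trans h
  rw [key] at h'
  have e : zsum β M - (M : ℝ) ^ (1 - β) / (1 - β) - (riemannZeta β).re =
      -((riemannZeta β).re - zsum β M + (M : ℝ) ^ (1 - β) / (1 - β)) := by ring
  rw [e, abs_neg]
  exact h'

/-- **`|ζ(β)| ≤ 1/(1−β)`** for `0 < β < 1` (the case `M = 1`: `|1 − 1/(1−β) − ζ(β)| ≤ 1` and
`1/(1−β) ≥ 1`). [folklore] -/
theorem abs_re_zeta_le (hβ0 : 0 < β) (hβ1 : β < 1) : |(riemannZeta β).re| ≤ 1 / (1 - β) := by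
  have h := abs_zsum_sub_sub_zeta_le hβ0 hβ1 (le_refl 1)
  rw [zsum_one, Nat.cast_one, Real.one_rpow, Real.one_rpow] at h
  have h3 : 1 ≤ 1 / (1 - β) := by
    rw [le_div_iff₀ (by linarith)]
    linarith
  rw [abs_le] at h ⊢
  constructor <;> linarith [h.1, h.2]

/-- **`Z_β(M) ≤ M^{1−β}/(1−β)`** for all `M` (`0 < β < 1`): the tree's
`SiegelZero.sum_Icc_rpow_le` (`Z_β(M) ≤ 1 + (M^{1−β} − 1)/(1−β)`) and `1 ≤ 1/(1−β)`. [folklore] -/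
theorem zsum_le (hβ0 : 0 < β) (hβ1 : β < 1) (M : ℕ) : zsum β M ≤ (M : ℝ) ^ (1 - β) / (1 - β) := by
  rcases Nat.eq_zero_or_pos M with rfl | hM
  · simp [Real.zero_rpow (by linarith : (1 : ℝ) - β ≠ 0)]
  · have h := SiegelZero.sum_Icc_rpow_le hβ0.le hβ1 hM
    rw [← zsum_eq_sum_Icc] at h
    have h3 : 1 ≤ 1 / (1 - β) := by
      rw [le_div_iff₀ (by linarith)]
      linarith
    have e : 1 + ((M : ℝ) ^ (1 - β) - 1) / (1 - β) = (M : ℝ) ^ (1 - β) / (1 - β) + (1 - 1 / (1 - β)) := by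
      ring
    linarith

/-- **Real-variable form**: for `t ≥ 1` and `0 < β < 1`,
`|Z_β(⌊t⌋) − t^{1−β}/(1−β) − ζ(β)| ≤ 4 t^{-β}`: the integer estimate at `M = ⌊t⌋`, the tree's
floor lemma `SiegelZero.rpow_sub_floor_rpow_bounds` (`0 ≤ (t^{1−β} − M^{1−β})/(1−β) ≤ M^{-β}`),
and `M^{-β} ≤ 2 t^{-β}` (`M ≥ t/2`). [cite: Titchmarsh1986, eq. (4.11.2)] -/
theorem abs_zsum_floor_sub_le (hβ0 : 0 < β) (hβ1 : β < 1) {t : ℝ} (ht : 1 ≤ t) :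
    |zsum β ⌊t⌋₊ - t ^ (1 - β) / (1 - β) - (riemannZeta β).re| ≤ 4 * t ^ (-β) := by
  set M := ⌊t⌋₊ with hMdef
  have hM1 : 1 ≤ M := Nat.le_floor (by simpa using ht)
  have hMt : (M : ℝ) ≤ t := Nat.floor_le (by linarith)
  have htM : t < M + 1 := Nat.lt_floor_add_one t
  have hMpos : (0 : ℝ) < M := by exact_mod_cast hM1
  have h1β : 0 < 1 - β := by linarith
  have hint := abs_zsum_sub_sub_zeta_le hβ0 hβ1 hM1
  have hfl := SiegelZero.rpow_sub_floor_rpow_bounds hβ0.le hβ1 ht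
  rw [← hMdef] at hfl
  have hup' : (t ^ (1 - β) - (M : ℝ) ^ (1 - β)) / (1 - β) ≤ (M : ℝ) ^ (-β) := by
    rw [div_le_iff₀ h1β]; linarith [hfl.2]
  have hlo' : 0 ≤ (t ^ (1 - β) - (M : ℝ) ^ (1 - β)) / (1 - β) := div_nonneg hfl.1 h1β.le
  -- `M^{-β} ≤ 2 t^{-β}` since `t ≤ 2M`
  have hM2 : (M : ℝ) ^ (-β) ≤ 2 * t ^ (-β) := by
    have ht2 : t ≤ 2 * M := by
      have : (1 : ℝ) ≤ M := by exact_mod_cast hM1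
      linarith
    have ht0 : 0 < t := by linarith
    calc (M : ℝ) ^ (-β) ≤ (t / 2) ^ (-β) :=
          Real.rpow_le_rpow_of_nonpos (by linarith) (by linarith) (by linarith)
      _ = 2 ^ β * t ^ (-β) := by
          rw [Real.div_rpow ht0.le (by norm_num), Real.rpow_neg (by norm_num : (0:ℝ) ≤ 2),
            div_eq_mul_inv, inv_inv, mul_comm]
      _ ≤ 2 ^ (1 : ℝ) * t ^ (-β) := by
          gcongr
          · norm_num
      _ = 2 * t ^ (-β) := by rw [Real.rpow_one]
  have key : zsum β M - t ^ (1 - β) / (1 - β) - (riemannZeta β).re =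
      (zsum β M - (M : ℝ) ^ (1 - β) / (1 - β) - (riemannZeta β).re) -
        (t ^ (1 - β) - (M : ℝ) ^ (1 - β)) / (1 - β) := by ring
  rw [key]
  have hint' := abs_le.mp hint
  rw [abs_le]
  constructor <;> nlinarith [Real.rpow_nonneg hMpos.le (-β)]

end PowerSum

/-! ## The smooth-number majorant for `∑_{n ≤ N} r(n)/n` -/

namespace RealChar

open DirichletAbel PowerSum

variable {q : ℕ} [NeZero q] (χ : DirichletCharacter ℂ q)

omit [NeZero q] in
/-- `r(n) = Re (1 ∗ χ)(n)` (bridge to Mathlib's `zetaMul`, as used in the tree's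
`SmoothEulerProductSandwich.lean`). [folklore] -/
theorem charDivisorSum_eq_zetaMul_re (hq : χ ^ 2 = 1) (n : ℕ) :
    charDivisorSum χ n = (χ.zetaMul n).re := by
  rw [← ofReal_charDivisorSum χ hq n, Complex.ofReal_re]

omit [NeZero q] in
/-- **`∑_{n ≤ N} r(n)/n ≤ ∏_{p ≤ N} ((1 − 1/p)(1 − χ(p)/p))⁻¹`** for quadratic `χ`: the
non-negative multiplicative function `r(n)/n` summed over `n ≤ N` is at most its sum over all
`(N+1)`-smooth numbers, which is the finite Euler product over `p ≤ N`. This is the tree's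
`Literature.NumberTheory.LFunctions.SmoothEulerProduct.sum_le_smoothProduct` (Mathlib's Euler
product over smooth numbers), restated for `r = charDivisorSum χ`. [cite: DavenportMNT1980, Ch. 6] -/
theorem sum_charDivisorSum_div_le_prod (hq : χ ^ 2 = 1) (N : ℕ) :
    ∑ n ∈ Ioc 0 N, charDivisorSum χ n / n ≤
      ∏ p ∈ Nat.primesBelow (N + 1), ((1 - (p : ℝ)⁻¹) * (1 - reChar χ p / p))⁻¹ := by
  have h := SmoothEulerProduct.sum_le_smoothProduct χ hq (x := N) (M := N + 1) (Nat.lt_succ_self N)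
  rw [show Finset.Icc 1 N = Finset.Ioc 0 N from rfl] at h
  calc ∑ n ∈ Ioc 0 N, charDivisorSum χ n / n = ∑ n ∈ Ioc 0 N, (χ.zetaMul n).re / n :=
        sum_congr rfl fun n _ => by rw [charDivisorSum_eq_zetaMul_re χ hq n]
    _ ≤ ∏ p ∈ (N + 1).primesBelow, (1 - (p : ℝ)⁻¹)⁻¹ * (1 - (χ p).re * (p : ℝ)⁻¹)⁻¹ := h
    _ = ∏ p ∈ Nat.primesBelow (N + 1), ((1 - (p : ℝ)⁻¹) * (1 - reChar χ p / p))⁻¹ := by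
        refine prod_congr rfl fun p hp => ?_
        rw [reChar_apply χ (Nat.prime_of_mem_primesBelow hp).ne_zero, mul_inv, div_eq_mul_inv]

end RealChar

end Literature.NumberTheory.LFunctions
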